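import Summits.QuantumFields.YangMills.Theorems.IR.Negative.OuterCertFalseOfWire
import Literature.MathematicalPhysics.QuantumLattice.LatticeGaugeDLRGibbsProofs
import Literature.MathematicalPhysics.QuantumFieldTheory.StrongCouplingActivities

/-!
# Tempering is inert at fixed `(β, b)`: `(∀ δ > 0, OuterTemperedCond ρ β b n ε δ) → UnivShellCond ρ β b n ε`

Negative-side bookkeeping for crux `IR` (item stmt-QuantumFields-19354, route BalabanLadder), skeleton v10
(`IR_birth_cell_v10.lean`, sha 88d42543849b7401), open stub `stub_outerCert : IROuterCertificate`; asked for by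
the owner's PICK-19354-r1 §3 (n2) and by both triage seats (card `tempering-inert`).

`OuterTemperedCond ρ β b n ε δ` (v10 :76, tree copy `OuterCertWire.OuterTemperedCond`) offers an `∃ Good` with two
clauses: (i♭) `ε`-insensitivity of centre-cell expectations to outer-shell data that are equal OR both `Good`, and
(ii) rarity `γ_{E'}((Good c)ᶜ | ζ) ≤ δ` under EVERY Wilson kernel `E' ⊇ cellEdges w c` and EVERY exterior `ζ`.
`UnivShellCond ρ β b n ε` (triage seat 1, `UnivBridgeProof.lean`; its body is the conclusion of the main theorem
below, verbatim) is (i♭) with `Good ≡ univ`: plain insensitivity to ARBITRARY outer-shell data.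

Kernel-checked here (no `sorry`, standard axioms), for a continuous representation `ρ` of a compact second-countable
group at FIXED `(β, b, n, ε)`:

* `exists_pi_map_glueWith_le_ymSpecification` — the Wilson kernel `γ_Λ(· | η)` dominates `c · (Haar^Λ glued into η)`
  with ONE constant `c = c(ρ, β, Λ) > 0` for all `η` and all events (the tilting density `e^{-β S_Λ}/Z_Λ(η)` is
  bounded below uniformly in the boundary condition).  Consequence (the fixed-`(β,b)` half of (R0)): clause (ii) at
  level `δ` forces `Haar^{E'}{v : v η ∉ Good c} ≤ δ / c` for every `η` — a `Good` of Haar co-mass `> δ / c` violates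
  sup-`ζ` rarity whatever the exterior (`pi_preimage_compl_le_of_rarity`).
* `continuous_integral_ymSpecification_of_isCylinder` — Feller continuity of `η ↦ ∫ f dγ_Λ(· | η)` for a bounded
  MEASURABLE cylinder `f` supported inside `Λ` (the tree's `continuous_integral_ymSpecification` wants `f` continuous;
  (i♭) quantifies over measurable `f`).
* `univShellCond_of_forall_outerTemperedCond` — **inertness**: if the outer-tempered condition holds for EVERY
  `δ > 0` at fixed `(ρ, β, b, n, ε)`, then the untempered `UnivShellCond ρ β b n ε` holds.  Proof: given shell data
  `σ, σ'` and `κ > 0`, continuity gives open sets of shell modifications moving `∫ f dγ_Y` by `< κ/2`; they have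
  positive product-Haar mass `q`; take `δ < q·c / #shell`; by the first bullet the `Good_δ`-violating modifications
  have mass `< q`, so some modification in the open set is `Good_δ` on every shell cell; (i♭) bounds the modified
  pair by `ε`; let `κ → 0`.

What this says about v10 (numbers, not adjectives): v10's certificate fixes `δ` BEFORE `β → ∞`
(`∀ δ > 0, ∃ β₂, ∀ β ≥ β₂`), so at a given `β` only `δ ≥ δ₀(β)` is available and this theorem does not apply to it
literally; it applies to every statement that offers `∀ δ > 0` at fixed `(β, b)` (e.g. `WindowCertificate` of card
rg-orbit-window, `PincerB` of af-pincer as first written), which are therefore EXACTLY the untempered condition.  Along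
`β → ∞` the constant `c(ρ, β, E_S) = e^{-2|β| sup|S_{E_S}|}` of the first bullet tends to `0`, so inertness of v10
itself rests on the untyped `CollarForcing` heuristic (card tempering-inert :44) — not claimed here.
-/

noncomputable section

open Filter Topology MeasureTheory
open Literature.MathematicalPhysics.QuantumFieldTheory Literature.MathematicalPhysics.QuantumLattice
open Literature.Probability.LatticeModels
open Summit.QuantumFields.YangMills.Cruxes.IR.Tempered (cellEdges windowCells regionEdges cellEdges_subset_regionEdges)
open Summit.QuantumFields.YangMills.Cruxes.IR.ShellTempered (windowCellsPlus)
open Summit.QuantumFields.YangMills.Cruxes.IR.OuterCertWire (OuterTemperedCond not_mem_cellEdges_of_ne)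

namespace Summit.QuantumFields.YangMills.Cruxes.IR.OuterCertInert

variable {G : Type} [Group G] [TopologicalSpace G] [IsTopologicalGroup G] [CompactSpace G]
  [MeasurableSpace G] [BorelSpace G]

/-! ## §1 The untempered shell condition

`UnivShellCond ρ β b n ε` of triage seat 1 (`UnivBridgeProof.lean`, evidence #60 on the item; not a tree
declaration) is (i♭) with `Good ≡ univ`: centre-cell expectations under the kernel of any region `Y ∋ 0` inside the
window are `ε`-insensitive to the data on the outer shell (cells of `windowCellsPlus n` outside `windowCells n`),
the window cells off `Y` carrying equal data.  To keep this file a pure-proof landing it is NOT re-declared here: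
the conclusion of `univShellCond_of_forall_outerTemperedCond` below is its body verbatim, so
`univShellCond_of_forall_outerTemperedCond hρ h : UnivShellCond ρ β b n ε` typechecks by `Iff.rfl`/unfolding
wherever that `def` is in scope. -/

/-! ## §2 Two kernel facts: a uniform lower density bound, and Feller continuity for measurable cylinders -/

section Kernel

variable [SecondCountableTopology G] {d N : ℕ} (ρ : G →* Matrix (Fin N) (Fin N) ℂ)

/-- **Uniform lower density bound.**  For a continuous representation there is ONE constant `c = c(ρ, β, Λ) > 0`
such that `c · Haar^Λ{ζ : ζ η_{Λᶜ} ∈ A} ≤ γ_Λ(A | η)` for every boundary condition `η` and every event `A`: the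
tilting density `e^{-β S_Λ} / Z_Λ(η)` lies in `[e^{-|β|B} / e^{|β|B}, …]` with `B = sup |S_Λ|`. [folklore] -/
theorem exists_pi_map_glueWith_le_ymSpecification (hρ : Continuous ρ) (β : ℝ) (Λ : Finset (Literature.MathematicalPhysics.QuantumLattice.ZdEdge d)) :
    ∃ c : ℝ, 0 < c ∧ ∀ (η : LGConfig d G) (A : Set (LGConfig d G)), MeasurableSet A →
      ENNReal.ofReal c * (Measure.pi fun _ : ↥Λ => haarProbability G) ((glueWith Λ · η) ⁻¹' A) ≤
        ymSpecification ρ β Λ η A := by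
  obtain ⟨B, hB⟩ := exists_bound_of_continuous (continuous_wilsonBoundaryAction ρ hρ Λ)
  refine ⟨Real.exp (-(|β| * B)) / Real.exp (|β| * B), div_pos (Real.exp_pos _) (Real.exp_pos _),
    fun η A hA => ?_⟩
  have hg : Measurable (glueWith Λ · η) := measurable_glueWith Λ η
  have hw : Continuous fun U : LGConfig d G => Real.exp (-β * wilsonBoundaryAction ρ Λ U) :=
    Real.continuous_exp.comp (continuous_const.mul (continuous_wilsonBoundaryAction ρ hρ Λ))
  have habs : ∀ U, |β * wilsonBoundaryAction ρ Λ U| ≤ |β| * B := fun U => by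
    rw [abs_mul]; exact mul_le_mul_of_nonneg_left (hB U) (abs_nonneg _)
  have hlo : ∀ U, Real.exp (-(|β| * B)) ≤ Real.exp (-β * wilsonBoundaryAction ρ Λ U) := fun U =>
    Real.exp_le_exp.2 (by rw [neg_mul]; linarith [le_abs_self (β * wilsonBoundaryAction ρ Λ U), habs U])
  have hhi : ∀ U, Real.exp (-β * wilsonBoundaryAction ρ Λ U) ≤ Real.exp (|β| * B) := fun U =>
    Real.exp_le_exp.2 (by rw [neg_mul]; linarith [neg_abs_le (β * wilsonBoundaryAction ρ Λ U), habs U])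
  haveI : IsProbabilityMeasure ((Measure.pi fun _ : ↥Λ => haarProbability G).map (glueWith Λ · η)) :=
    Measure.isProbabilityMeasure_map hg.aemeasurable
  have hZint : Integrable (fun U => Real.exp (-β * wilsonBoundaryAction ρ Λ U))
      ((Measure.pi fun _ : ↥Λ => haarProbability G).map (glueWith Λ · η)) :=
    integrable_of_bound hw.aestronglyMeasurable (C := Real.exp (|β| * B)) fun U => by
      rw [abs_of_pos (Real.exp_pos _)]; exact hhi U
  have hZpos : 0 < ∫ U, Real.exp (-β * wilsonBoundaryAction ρ Λ U)
      ∂((Measure.pi fun _ : ↥Λ => haarProbability G).map (glueWith Λ · η)) := integral_exp_pos hZint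
  have hZle : ∫ U, Real.exp (-β * wilsonBoundaryAction ρ Λ U)
      ∂((Measure.pi fun _ : ↥Λ => haarProbability G).map (glueWith Λ · η)) ≤ Real.exp (|β| * B) := by
    have h := integral_mono hZint (integrable_const (Real.exp (|β| * B))) fun U => hhi U
    simpa using h
  have hconst : ∀ a : LGConfig d G,
      ENNReal.ofReal (Real.exp (-(|β| * B)) / Real.exp (|β| * B)) ≤
        ENNReal.ofReal (Real.exp (-β * wilsonBoundaryAction ρ Λ a) /
          ∫ U, Real.exp (-β * wilsonBoundaryAction ρ Λ U)
            ∂((Measure.pi fun _ : ↥Λ => haarProbability G).map (glueWith Λ · η))) := fun a =>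
    ENNReal.ofReal_le_ofReal
      ((div_le_div_of_nonneg_left (Real.exp_pos _).le hZpos hZle).trans
        (div_le_div_of_nonneg_right (hlo a) hZpos.le))
  unfold ymSpecification
  rw [tilted_apply' _ _ hA]
  calc ENNReal.ofReal (Real.exp (-(|β| * B)) / Real.exp (|β| * B)) *
        (Measure.pi fun _ : ↥Λ => haarProbability G) ((glueWith Λ · η) ⁻¹' A)
      = ENNReal.ofReal (Real.exp (-(|β| * B)) / Real.exp (|β| * B)) *
          ((Measure.pi fun _ : ↥Λ => haarProbability G).map (glueWith Λ · η)) A := by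
        rw [Measure.map_apply hg hA]
    _ = ∫⁻ _ in A, ENNReal.ofReal (Real.exp (-(|β| * B)) / Real.exp (|β| * B))
          ∂((Measure.pi fun _ : ↥Λ => haarProbability G).map (glueWith Λ · η)) := by
        rw [setLIntegral_const]
    _ ≤ _ := lintegral_mono fun a => hconst a

/-- **Fixed-`(β, Λ)` half of (R0)**: sup-`ζ` rarity at level `δ` under one kernel `γ_Λ` bounds the product-Haar
co-mass of `Good` glued into ANY configuration: `Haar^Λ{ζ : ζ η_{Λᶜ} ∉ Good} ≤ δ / c(ρ, β, Λ)`.  So a field-sensitive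
`Good` (Haar co-mass `> δ / c`) violates clause (ii) for every exterior, wild or not. [folklore] -/
theorem pi_preimage_compl_le_of_rarity (hρ : Continuous ρ) (β : ℝ) (Λ : Finset (Literature.MathematicalPhysics.QuantumLattice.ZdEdge d)) :
    ∃ c : ℝ, 0 < c ∧ ∀ (Good : Set (LGConfig d G)), MeasurableSet Good → ∀ δ : ℝ,
      (∀ ζ : LGConfig d G, ymSpecification ρ β Λ ζ Goodᶜ ≤ ENNReal.ofReal δ) →
      ∀ η : LGConfig d G,
        (Measure.pi fun _ : ↥Λ => haarProbability G) ((glueWith Λ · η) ⁻¹' Goodᶜ) ≤ ENNReal.ofReal (δ / c) := by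
  obtain ⟨c, hc, hlow⟩ := exists_pi_map_glueWith_le_ymSpecification ρ hρ β Λ
  refine ⟨c, hc, fun Good hGood δ hrare η => ?_⟩
  rw [ENNReal.ofReal_div_of_pos hc]
  refine (ENNReal.le_div_iff_mul_le (Or.inl (ENNReal.ofReal_pos.2 hc).ne') (Or.inl ENNReal.ofReal_ne_top)).2 ?_
  rw [mul_comm]
  exact (hlow η Goodᶜ hGood.compl).trans (hrare η)

/-- **Feller continuity for measurable cylinder observables supported in the region**: for a bounded measurable
`F` with `F U` depending only on `U|_{S₀}`, `S₀ ⊆ Λ`, the kernel average `η ↦ ∫ F dγ_Λ(· | η)` is continuous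
(inside `Λ` the glued configuration does not see `η`, and the Wilson weight is jointly continuous). [folklore] -/
theorem continuous_integral_ymSpecification_of_isCylinder (hρ : Continuous ρ) (β : ℝ) (Λ : Finset (Literature.MathematicalPhysics.QuantumLattice.ZdEdge d))
    {F : LGConfig d G → ℝ} (hF : Measurable F) {S₀ : Finset (Literature.MathematicalPhysics.QuantumLattice.ZdEdge d)} (hFS : IsCylinder F S₀) (hS₀ : S₀ ⊆ Λ)
    {C : ℝ} (hC : ∀ U, |F U| ≤ C) :
    Continuous fun η => ∫ U, F U ∂(ymSpecification ρ β Λ η) := by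
  have hw : Continuous fun U : LGConfig d G => Real.exp (-β * wilsonBoundaryAction ρ Λ U) :=
    Real.continuous_exp.comp (continuous_const.mul (continuous_wilsonBoundaryAction ρ hρ Λ))
  obtain ⟨B, hB⟩ := exists_bound_of_continuous hw
  have hFglue : ∀ (ζ : ↥Λ → G) (η η' : LGConfig d G), F (glueWith Λ ζ η) = F (glueWith Λ ζ η') := by
    intro ζ η η'
    refine hFS fun e he => ?_
    have heΛ : e ∈ Λ := hS₀ (Finset.mem_coe.1 he)
    simp [glueWith_apply_mem _ _ _ heΛ]
  have hnum : Continuous fun η : LGConfig d G =>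
      ∫ ζ, F (glueWith Λ ζ η) * Real.exp (-β * wilsonBoundaryAction ρ Λ (glueWith Λ ζ η))
        ∂(Measure.pi fun _ : ↥Λ => haarProbability G) := by
    refine continuous_of_dominated (bound := fun _ => |C| * B) ?_ ?_ (integrable_const _) ?_
    · intro η
      exact ((hF.comp (measurable_glueWith Λ η)).mul
        (hw.measurable.comp (measurable_glueWith Λ η))).aestronglyMeasurable
    · intro η
      refine ae_of_all _ fun ζ => ?_
      rw [Real.norm_eq_abs, abs_mul]
      exact mul_le_mul ((hC _).trans (le_abs_self C)) (hB _) (abs_nonneg _) (abs_nonneg C)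
    · refine ae_of_all _ fun ζ => ?_
      have hc1 : Continuous fun η : LGConfig d G => F (glueWith Λ ζ η) := by
        have h1 : (fun η : LGConfig d G => F (glueWith Λ ζ η)) = fun _ => F (glueWith Λ ζ fun _ => 1) :=
          funext fun η => hFglue ζ η (fun _ => 1)
        rw [h1]; exact continuous_const
      have hc2 : Continuous fun η : LGConfig d G =>
          Real.exp (-β * wilsonBoundaryAction ρ Λ (glueWith Λ ζ η)) :=
        hw.comp ((continuous_glueWith_prod Λ).comp (Continuous.prodMk_left ζ))
      exact hc1.mul hc2
  have hZ : Continuous fun η : LGConfig d G =>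
      ∫ ζ, Real.exp (-β * wilsonBoundaryAction ρ Λ (glueWith Λ ζ η))
        ∂(Measure.pi fun _ : ↥Λ => haarProbability G) := by
    have h := continuous_integral_glueWith ρ hρ β Λ (F := fun _ => (1 : ℝ)) continuous_const
      (C := 1) (fun _ => by simp)
    simpa using h
  simp only [integral_ymSpecification ρ hρ β Λ hF]
  exact hnum.div hZ fun η => (normaliser_pos ρ hρ β Λ η).ne'

end Kernel

/-! ## §3 Inertness at fixed `(β, b)` -/

/-- **Tempering is inert at fixed parameters.**  For a continuous representation `ρ` of a compact second-countable
group: if the outer-tempered condition `OuterTemperedCond ρ β b n ε δ` holds for EVERY `δ > 0` (at the same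
`ρ, β, b, n, ε`), then the untempered shell condition holds (the conclusion is the body of seat 1's
`UnivShellCond ρ β b n ε`, verbatim) — the `∃ Good` of v10 buys nothing once all rarity levels are available at
one coupling. -/
theorem univShellCond_of_forall_outerTemperedCond [SecondCountableTopology G] {N : ℕ}
    {ρ : G →* Matrix (Fin N) (Fin N) ℂ} (hρ : Continuous ρ) {β : ℝ} {b n : ℕ} {ε : ℝ}
    (h : ∀ δ : ℝ, 0 < δ → OuterTemperedCond ρ β b n ε δ) :
    ∀ w : Fin 4 → ℤ → ℤ, (∀ i j, w i j + ((b : ℕ) : ℤ) ≤ w i (j + 1) ∧ w i (j + 1) ≤ w i j + 2 * ((b : ℕ) : ℤ)) →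
      ∀ Y : Finset (Fin 4 → ℤ), Y ⊆ windowCells n → (0 : Fin 4 → ℤ) ∈ Y →
        ∀ σ σ' : LGConfig 4 G,
          (∀ c ∈ windowCellsPlus n, c ∉ Y → c ∈ windowCells n → ∀ e ∈ cellEdges w c, σ e = σ' e) →
          ∀ f : LGConfig 4 G → ℝ, IsCylinder f (cellEdges w 0) → Measurable f → (∀ U, 0 ≤ f U ∧ f U ≤ 1) →
            |(∫ U, f U ∂(ymSpecification ρ β (regionEdges w Y) σ)) -
              ∫ U, f U ∂(ymSpecification ρ β (regionEdges w Y) σ')| ≤ ε := by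
  classical
  intro w hw Y hY h0 σ σ' hagree f hf hfm hf01
  -- the shell cells, their edges, the product Haar measure on shell modifications
  set Λ : Finset (Literature.MathematicalPhysics.QuantumLattice.ZdEdge 4) := regionEdges w Y with hΛdef
  set Sh : Finset (Fin 4 → ℤ) := (windowCellsPlus n).filter fun c => c ∉ windowCells n with hShdef
  set ES : Finset (Literature.MathematicalPhysics.QuantumLattice.ZdEdge 4) := regionEdges w Sh with hESdef
  set πS : Measure (↥ES → G) := Measure.pi fun _ : ↥ES => haarProbability G with hπSdef
  -- the observable's kernel average as a function of the full datum
  set E : LGConfig 4 G → ℝ := fun η => ∫ U, f U ∂(ymSpecification ρ β Λ η) with hEdef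
  have hfC : ∀ U, |f U| ≤ 1 := fun U => abs_le.2 ⟨by linarith [(hf01 U).1], (hf01 U).2⟩
  have hEcont : Continuous E :=
    continuous_integral_ymSpecification_of_isCylinder ρ hρ β Λ hfm hf (cellEdges_subset_regionEdges w h0) hfC
  -- shell modifications of σ and σ'
  set T : (↥ES → G) → LGConfig 4 G := fun v => glueWith ES v σ with hTdef
  set T' : (↥ES → G) → LGConfig 4 G := fun v => glueWith ES v σ' with hT'def
  have hTcont : Continuous T := (continuous_glueWith_prod ES).comp (Continuous.prodMk_right σ)
  have hT'cont : Continuous T' := (continuous_glueWith_prod ES).comp (Continuous.prodMk_right σ')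
  have hT0 : T (fun e => σ e) = σ := by
    funext e
    by_cases he : e ∈ ES
    · simp [hTdef, glueWith_apply_mem _ _ _ he]
    · simp [hTdef, glueWith_apply_not_mem _ _ _ he]
  have hT'0 : T' (fun e => σ' e) = σ' := by
    funext e
    by_cases he : e ∈ ES
    · simp [hT'def, glueWith_apply_mem _ _ _ he]
    · simp [hT'def, glueWith_apply_not_mem _ _ _ he]
  -- the lower density constant of the shell kernel
  obtain ⟨c₀, hc₀, hlow⟩ := exists_pi_map_glueWith_le_ymSpecification ρ hρ β ES
  -- it suffices to prove the bound up to an arbitrary κ > 0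
  refine le_of_forall_pos_le_add fun κ hκ => ?_
  -- open sets of modifications that move the expectation by < κ/2
  set V : Set (↥ES → G) := {v | |E (T v) - E σ| < κ / 2} with hVdef
  set V' : Set (↥ES → G) := {v | |E (T' v) - E σ'| < κ / 2} with hV'def
  have hVo : IsOpen V :=
    isOpen_lt (continuous_abs.comp ((hEcont.comp hTcont).sub continuous_const)) continuous_const
  have hV'o : IsOpen V' :=
    isOpen_lt (continuous_abs.comp ((hEcont.comp hT'cont).sub continuous_const)) continuous_const
  have hVne : V.Nonempty := ⟨fun e => σ e, by
    show |E (T fun e => σ e) - E σ| < κ / 2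
    rw [hT0, sub_self, abs_zero]; positivity⟩
  have hV'ne : V'.Nonempty := ⟨fun e => σ' e, by
    show |E (T' fun e => σ' e) - E σ'| < κ / 2
    rw [hT'0, sub_self, abs_zero]; positivity⟩
  have hVpos : 0 < πS V := hVo.measure_pos πS hVne
  have hV'pos : 0 < πS V' := hV'o.measure_pos πS hV'ne
  have hfinV : πS V ≠ ⊤ := measure_ne_top πS V
  have hfinV' : πS V' ≠ ⊤ := measure_ne_top πS V'
  -- the rarity level δ
  set q : ℝ := min (πS V).toReal (πS V').toReal with hqdef
  have hqpos : 0 < q :=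
    lt_min (ENNReal.toReal_pos hVpos.ne' hfinV) (ENNReal.toReal_pos hV'pos.ne' hfinV')
  set δ : ℝ := q * c₀ / (2 * ((Sh.card : ℝ) + 1)) with hδdef
  have hδpos : 0 < δ := by positivity
  have hlt : (Sh.card : ℝ) * (δ / c₀) < q := by
    have h1 : (Sh.card : ℝ) * (δ / c₀) = q * ((Sh.card : ℝ) / (2 * ((Sh.card : ℝ) + 1))) := by
      rw [hδdef]; field_simp
    rw [h1]
    refine mul_lt_of_lt_one_right hqpos ?_
    rw [div_lt_one (by positivity)]
    linarith
  obtain ⟨Good, hGm, -, hflat, hrare⟩ := h δ hδpos w hw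
  -- under product Haar, the modifications failing to be Good on some shell cell have mass < q
  have hbad : ∀ τ : LGConfig 4 G,
      πS (⋃ c ∈ Sh, (fun v : ↥ES → G => glueWith ES v τ) ⁻¹' (Good c)ᶜ) ≤
        ENNReal.ofReal ((Sh.card : ℝ) * (δ / c₀)) := by
    intro τ
    calc πS (⋃ c ∈ Sh, (fun v : ↥ES → G => glueWith ES v τ) ⁻¹' (Good c)ᶜ)
        ≤ ∑ c ∈ Sh, πS ((fun v : ↥ES → G => glueWith ES v τ) ⁻¹' (Good c)ᶜ) :=
          measure_biUnion_finset_le Sh _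
      _ ≤ ∑ c ∈ Sh, ENNReal.ofReal (δ / c₀) := Finset.sum_le_sum fun c hc => by
          have hsub : cellEdges w c ⊆ ES := fun e he => by
            rw [hESdef]
            exact Finset.mem_biUnion.2 ⟨c, hc, he⟩
          rw [ENNReal.ofReal_div_of_pos hc₀]
          refine (ENNReal.le_div_iff_mul_le (Or.inl (ENNReal.ofReal_pos.2 hc₀).ne')
            (Or.inl ENNReal.ofReal_ne_top)).2 ?_
          rw [mul_comm]
          exact (hlow τ (Good c)ᶜ (hGm c).compl).trans (hrare c ES hsub τ)
      _ = ENNReal.ofReal ((Sh.card : ℝ) * (δ / c₀)) := by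
          rw [Finset.sum_const, nsmul_eq_mul, ENNReal.ofReal_mul (Nat.cast_nonneg _), ENNReal.ofReal_natCast]
  -- hence an open set of mass ≥ q contains a modification that is Good on every shell cell
  have hex : ∀ (τ : LGConfig 4 G) (W : Set (↥ES → G)), ENNReal.ofReal q ≤ πS W →
      ∃ v ∈ W, ∀ c ∈ Sh, glueWith ES v τ ∈ Good c := by
    intro τ W hW
    by_contra hne
    push Not at hne
    have hsub : W ⊆ ⋃ c ∈ Sh, (fun v : ↥ES → G => glueWith ES v τ) ⁻¹' (Good c)ᶜ := fun v hv => by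
      obtain ⟨c, hc, hv'⟩ := hne v hv
      exact Set.mem_iUnion₂.2 ⟨c, hc, hv'⟩
    have h1 := (hW.trans (measure_mono hsub)).trans (hbad τ)
    exact absurd h1 (not_le.2 ((ENNReal.ofReal_lt_ofReal_iff hqpos).2 hlt))
  obtain ⟨v, hvV, hvG⟩ := hex σ V
    ((ENNReal.ofReal_le_ofReal (min_le_left _ _)).trans (ENNReal.ofReal_toReal hfinV).le)
  obtain ⟨v', hv'V, hv'G⟩ := hex σ' V'
    ((ENNReal.ofReal_le_ofReal (min_le_right _ _)).trans (ENNReal.ofReal_toReal hfinV').le)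
  -- the modified pair is admissible for (i♭)
  have hpair : ∀ c ∈ windowCellsPlus n, c ∉ Y →
      ((∀ e ∈ cellEdges w c, T v e = T' v' e) ∨ (c ∉ windowCells n ∧ T v ∈ Good c ∧ T' v' ∈ Good c)) := by
    intro c hc hcY
    by_cases hcw : c ∈ windowCells n
    · left
      intro e he
      have heES : e ∉ ES := by
        intro heES
        rw [hESdef] at heES
        obtain ⟨c', hc', he'⟩ := Finset.mem_biUnion.1 heES
        have hc'w : c' ∉ windowCells n := (Finset.mem_filter.1 hc').2
        exact not_mem_cellEdges_of_ne hw (fun hcc : c = c' => hc'w (hcc ▸ hcw)) he he'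
      simp only [hTdef, hT'def, glueWith_apply_not_mem _ _ _ heES]
      exact hagree c hc hcY hcw e he
    · right
      exact ⟨hcw, hvG c (Finset.mem_filter.2 ⟨hc, hcw⟩), hv'G c (Finset.mem_filter.2 ⟨hc, hcw⟩)⟩
  have hmid : |E (T v) - E (T' v')| ≤ ε := hflat Y hY h0 (T v) (T' v') hpair f hf hfm hf01
  have h1 : |E (T v) - E σ| < κ / 2 := hvV
  have h2 : |E (T' v') - E σ'| < κ / 2 := hv'V
  show |E σ - E σ'| ≤ ε + κ
  have h3 := abs_sub_le (E σ) (E (T v)) (E σ')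
  have h4 := abs_sub_le (E (T v)) (E (T' v')) (E σ')
  rw [abs_sub_comm] at h1
  linarith

end Summit.QuantumFields.YangMills.Cruxes.IR.OuterCertInert
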